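import Literature.AlgebraicGeometry.Frobenioids.PadicFrobenioidQpSplit
import Literature.AnabelianGeometry.EtaleTheta.TemperedFrobenioidToy
import Literature.AnabelianGeometry.EtaleTheta.TemperedFrobenioidCor38Sub
import HarnessLib

/-!
# [EtTh] Cor. 3.8, proof row `PreservesLinear` (C38-L04, degree half): RIGIDITY at the toy tempered
# Frobenioid — EVERY equivalence of its model-Frobenioid category preserves `deg_Fr = 1`

S. Mochizuki, *The étale theta function and its Frobenioid-theoretic manifestations*, Publ. RIMS **45**
(2009) [MochizukiEtTh2009], Cor. 3.8 and its proof, PDF p. 81 l. 5–8: "`Ψ` preserves … [cf. [Mzk17],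
Theorem 3.4, (iii)]" the Frobenius degrees, in particular the linear morphisms [cite: MochizukiEtTh2009, Cor 3.8 p.81];
S. Mochizuki, *The geometry of Frobenioids I*, Kyushu J. Math. **62** (2008), Thm. 3.4 (iii) p. 62
[cite: MochizukiFrdI2008, Thm. 3.4 (iii) p.62].

abc-iut cell, block F (FACT-LIST fact-proving wave), seat abc-iut-f-136 (gen 3), FLOAT row **F-2815**
`Cor38Hyp.PreservesLinear` (abc-iut-w5-d124's sub-DAG file `TemperedFrobenioidCor38Sub.lean`; class
`preparatory`, kernel_closedness `parametrised` — the parameter is a record `h : Cor38Hyp C₁ C₂`, i.e. an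
ARBITRARY equivalence `Ψ` of the model-Frobenioid categories plus "FSMFF base" and the VACUOUS vocabulary
clause "non-dilating").  Instance forms of record: abc-iut-f-001 `preservesLinear_treeCatVocab` (p430635, modulo
the named fact [FrdI] Thm. 3.4 (iii)), `preservesLinear_of_thm34iii`; abc-iut-f-134 (p433309) showed that BOTH
separating records used against the neighbouring rows F-2813/F-2814/F-2816 (two structures with `Ψ = 𝟭`; the
Frobenius-degree twist) satisfy F-2815 and left its bare closure undecided.

THIS file proves a kernel datum in the direction of the closure: over abc-iut-L2-t3's toy tempered Frobenioid
`Toy.temperedFrobenioid` (one-object base, `Φ = Φ^{ℝ-log} = ℕ`, `B = ℤ`, `Div_B(n) = 𝔭ⁿ`, trivial vocabularies;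
`TemperedFrobenioidToy.lean`) the row holds for EVERY record `h : Cor38Hyp Toy.temperedFrobenioid
Toy.temperedFrobenioid` — i.e. for every self-equivalence `Ψ` whatsoever of its category
(`Toy.preservesLinear_of_cor38Hyp`), and such records exist (`Toy.nonempty_cor38Hyp`).  The proof is an
INTRINSIC characterisation of linearity in that category, transported along any fully faithful functor:
* an endomorphism `t` of an object is linear iff it is LEFT-NORMAL, `∀ x ∃ t', t ≫ x = x ≫ t'`
  (`Toy.degFr_eq_one_iff_leftNormal`: translations can be pushed past any `x`, with `t'` the translation by
  `deg(x)·Div(t)`; an endomorphism of degree `e ≥ 2` cannot be pushed past the translation by `Div(t) + 1`);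
* a morphism `φ : X → Y` is linear iff every left-normal endomorphism of `Y` can be pulled back through `φ`,
  `∀ ℓ' left-normal ∃ ℓ, φ ≫ ℓ' = ℓ ≫ φ` (`Toy.degFr_eq_one_iff_pullsLeftNormal`: for `deg φ = e ≥ 2` the
  translation by one prime does not pull back, `1 = e·c` being insoluble);
* both properties are stated in the language of `Hom`/`≫` alone, hence reflected and preserved by any fully
  faithful functor (`pullsLeftNormal_map_of_full_faithful`, general category theory).
Reading (cell rule R5): an instance-FAMILY form of F-2815 (all `Ψ` at one record pair), supporting — not
proving — the conjecture that the bare closure is TRUE (desk census of six separating-model families,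
HOME/staging/f/f-136/g3/F-2815-CLOSURE-CENSUS-f136g3.md: every object receives morphisms of ALL Frobenius
degrees from an anchor `(A, −q)`, which pins degrees under any equivalence).  HONEST FRAMING: a statement about
OUR typed toy record; refereed pre-IUT material; nothing here bears on the disputed [IUTchIII] Cor. 3.12; no side
taken; typed ≠ proved.
-/

noncomputable section

namespace Literature.AnabelianGeometry.EtaleTheta

open CategoryTheory Opposite Literature.AlgebraicGeometry.Frobenioids

/-! ### §1  Transport of "pulls back left-normal endomorphisms" along fully faithful functors -/

section Transport

variable {C₁ : Type*} [Category C₁] {C₂ : Type*} [Category C₂] (F : C₁ ⥤ C₂) [F.Full] [F.Faithful]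

/-- A fully faithful functor REFLECTS left-normality of endomorphisms: if `ℓ'` on `F Y` satisfies
`∀ y ∃ ℓ'', ℓ' ≫ y = y ≫ ℓ''`, so does its preimage on `Y`. [folklore] -/
private theorem leftNormal_preimage_of_full_faithful {Y : C₁} (ℓ' : F.obj Y ⟶ F.obj Y)
    (h : ∀ y : F.obj Y ⟶ F.obj Y, ∃ ℓ'' : F.obj Y ⟶ F.obj Y, ℓ' ≫ y = y ≫ ℓ'') (y : Y ⟶ Y) :
    ∃ m : Y ⟶ Y, F.preimage ℓ' ≫ y = y ≫ m := by
  obtain ⟨ℓ'', hℓ''⟩ := h (F.map y)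
  refine ⟨F.preimage ℓ'', F.map_injective ?_⟩
  rw [F.map_comp, F.map_comp, F.map_preimage, F.map_preimage, hℓ'']

/-- A fully faithful functor PRESERVES the property "every left-normal endomorphism of the target pulls back
through `φ`" (a `Hom`/`≫`-only property). [folklore] -/
private theorem pullsLeftNormal_map_of_full_faithful {X Y : C₁} (φ : X ⟶ Y)
    (hφ : ∀ ℓ' : Y ⟶ Y, (∀ y : Y ⟶ Y, ∃ ℓ'' : Y ⟶ Y, ℓ' ≫ y = y ≫ ℓ'') →
      ∃ ℓ : X ⟶ X, φ ≫ ℓ' = ℓ ≫ φ)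
    (ℓ' : F.obj Y ⟶ F.obj Y) (hℓ' : ∀ y : F.obj Y ⟶ F.obj Y, ∃ ℓ'' : F.obj Y ⟶ F.obj Y, ℓ' ≫ y = y ≫ ℓ'') :
    ∃ ℓ : F.obj X ⟶ F.obj X, F.map φ ≫ ℓ' = ℓ ≫ F.map φ := by
  obtain ⟨ℓ, hℓ⟩ := hφ (F.preimage ℓ') (leftNormal_preimage_of_full_faithful F ℓ' hℓ')
  refine ⟨F.map ℓ, ?_⟩
  rw [show ℓ' = F.map (F.preimage ℓ') from (F.map_preimage ℓ').symm, ← F.map_comp, hℓ, F.map_comp]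

end Transport

/-! ### §2  The toy tempered Frobenioid: morphisms are determined by `(deg_Fr, Div)`; translations -/

namespace Toy

/-- `div₀(k) = 𝔭^k` on non-negative integers. [cite: MochizukiEtTh2009, Def 3.3 p.73] -/
private theorem divHom_ofAdd_coe (k : ℕ) :
    divHom (Multiplicative.ofAdd (k : ℤ)) = Algebra.GrothendieckGroup.of (Multiplicative.ofAdd k) := by
  rw [divHom, zpowersHom_apply, toAdd_ofAdd, zpow_natCast, ← map_pow, ← ofAdd_nsmul, smul_eq_mul, mul_one]

/-- `Div_B : B₀ = ℤ → ℕ^gp`, `n ↦ 𝔭ⁿ`, is injective (the toy has no units: `O^× = 1`).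
[cite: MochizukiEtTh2009, Def 3.3 p.73] -/
theorem divHom_injective : Function.Injective divHom := by
  let L : Algebra.GrothendieckGroup (Multiplicative ℕ) →* Multiplicative ℤ :=
    Algebra.GrothendieckGroup.lift (Nat.castAddMonoidHom ℤ).toMultiplicative
  have hLof : ∀ m : Multiplicative ℕ,
      L (Algebra.GrothendieckGroup.of m) = (Nat.castAddMonoidHom ℤ).toMultiplicative m := by
    intro m
    have e := Algebra.GrothendieckGroup.lift.symm_apply_apply (Nat.castAddMonoidHom ℤ).toMultiplicative
    rw [Algebra.GrothendieckGroup.lift_symm_apply] at e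
    exact DFunLike.congr_fun e m
  have key : ∀ x : Multiplicative ℤ, L (divHom x) = x := by
    intro x
    rw [divHom, zpowersHom_apply, map_zpow, hLof]
    simp only [AddMonoidHom.coe_toMultiplicative, Function.comp_apply, toAdd_ofAdd, Nat.coe_castAddMonoidHom,
      Nat.cast_one]
    rw [← ofAdd_zsmul, smul_eq_mul, mul_one, ofAdd_toAdd]
  intro a b h
  have := congrArg L h
  rwa [key, key] at this

/-- `Div_B` of the toy's model-Frobenioid data is the second projection of `B = B₀^Λ ×_{(Φ^{ℝ-log})^gp} Φ^gp`.
[cite: MochizukiEtTh2009, Def 3.6 p.77] -/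
theorem divB_apply (A : (Discrete PUnit.{1})ᵒᵖ) (u : temperedFrobenioid.ratFnFunctor.obj A) :
    divB temperedFrobenioid.divisorMonoid temperedFrobenioid.ratFnFunctor temperedFrobenioid.divBNatTrans A u =
      u.1.2 := rfl

/-- Zero divisors of the toy, read in `ℕ`: products add. [cite: MochizukiEtTh2009, Def 3.6 p.77] -/
theorem toAdd_val_mul {A : (Discrete PUnit.{1})ᵒᵖ} (a b : temperedFrobenioid.divisorMonoid.obj A) :
    Multiplicative.toAdd (α := ℕ) (a * b).1 =
      Multiplicative.toAdd (α := ℕ) a.1 + Multiplicative.toAdd (α := ℕ) b.1 := rfl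

/-- Zero divisors of the toy, read in `ℕ`: powers multiply. [cite: MochizukiEtTh2009, Def 3.6 p.77] -/
theorem toAdd_val_pow {A : (Discrete PUnit.{1})ᵒᵖ} (a : temperedFrobenioid.divisorMonoid.obj A) (n : ℕ) :
    Multiplicative.toAdd (α := ℕ) (a ^ n).1 = n * Multiplicative.toAdd (α := ℕ) a.1 := by
  induction n with
  | zero => rw [pow_zero, Nat.zero_mul]; rfl
  | succ n ih => rw [pow_succ, toAdd_val_mul, ih, Nat.succ_mul]

/-- In the toy category two morphisms `X → Y` with the same Frobenius degree and the same zero divisor are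
EQUAL: the base is the one-object category and `u_φ` is recovered from relation (d) (`Div_B` injective).
[cite: MochizukiFrdI2008, Thm. 5.2(i) p.100] -/
theorem hom_eq_of_degFr_eq_of_div_eq {X Y : temperedFrobenioid.category} {φ ψ : X ⟶ Y}
    (hd : ModelFrobenioid.degFr φ = ModelFrobenioid.degFr ψ) (hz : ModelFrobenioid.div φ = ModelFrobenioid.div ψ) :
    φ = ψ := by
  have hb : ModelFrobenioid.baseMap φ = ModelFrobenioid.baseMap ψ := Subsingleton.elim _ _
  have r₁ := ModelFrobenioid.rel φ
  have r₂ := ModelFrobenioid.rel ψ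
  rw [hd, hz, hb] at r₁
  have h2 : (ModelFrobenioid.unit φ).1.2 = (ModelFrobenioid.unit ψ).1.2 := by
    have e := congrArg (fun g => (pullGp temperedFrobenioid.divisorMonoid (ModelFrobenioid.baseMap ψ) Y.cls)⁻¹ * g)
      (r₁.symm.trans r₂)
    rw [inv_mul_cancel_left, inv_mul_cancel_left, divB_apply, divB_apply] at e
    exact e
  have h1 : (ModelFrobenioid.unit φ).1.1 = (ModelFrobenioid.unit ψ).1.1 := by
    apply divHom_injective
    have e₁ : divHom (ModelFrobenioid.unit φ).1.1 = temperedFrobenioid.ΦgpToRlog _ (ModelFrobenioid.unit φ).1.2 :=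
      (ModelFrobenioid.unit φ).2
    have e₂ : divHom (ModelFrobenioid.unit ψ).1.1 = temperedFrobenioid.ΦgpToRlog _ (ModelFrobenioid.unit ψ).1.2 :=
      (ModelFrobenioid.unit ψ).2
    rw [e₁, e₂, h2]
  exact ModelFrobenioid.hom_ext hd hb hz (Subtype.ext (Prod.ext h1 h2))

/-- Pull-back of divisors along the base map of an ENDOmorphism is the identity (one-object base).
[cite: MochizukiEtTh2009, Def 3.6 p.77] -/
theorem divisorMonoid_map_baseMap_apply {X : temperedFrobenioid.category} (t : X ⟶ X)
    (w : temperedFrobenioid.divisorMonoid.obj (op X.base)) :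
    (temperedFrobenioid.divisorMonoid.map (ModelFrobenioid.baseMap t).op).hom w = w := by
  rw [Subsingleton.elim (ModelFrobenioid.baseMap t) (𝟙 _), op_id, temperedFrobenioid.divisorMonoid.map_id]
  rfl

/-- Pull-back of divisors along ANY base map preserves the underlying element of `ℕ` (all transition maps of
the toy data are identities). [cite: MochizukiEtTh2009, Def 3.6 p.77] -/
theorem coe_divisorMonoid_map {A A' : (Discrete PUnit.{1})ᵒᵖ} (f : A ⟶ A')
    (w : temperedFrobenioid.divisorMonoid.obj A) :
    ((temperedFrobenioid.divisorMonoid.map f).hom w).1 = w.1 := rfl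

/-- **Translations.** Every object `X` of the toy category carries, for every effective divisor `z`, a
(unique) LINEAR endomorphism with zero divisor `z` — `(1, id, z, 𝔭^z)`. [cite: MochizukiFrdI2008, Thm. 5.2(i) p.100] -/
theorem exists_translation (X : temperedFrobenioid.category)
    (z : temperedFrobenioid.divisorMonoid.obj (op X.base)) :
    ∃ t : X ⟶ X, ModelFrobenioid.degFr t = 1 ∧ ModelFrobenioid.div t = z := by
  have hmem : ((Multiplicative.ofAdd ((Multiplicative.toAdd z.1 : ℕ) : ℤ) : Multiplicative ℤ),
      Algebra.GrothendieckGroup.of z) ∈ temperedFrobenioid.ratFn (op X.base) := by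
    change divHom _ = temperedFrobenioid.ΦgpToRlog _ (Algebra.GrothendieckGroup.of z)
    rw [divHom_ofAdd_coe, ofAdd_toAdd, TemperedFrobenioid.ΦgpToRlog, gpMap_of]
    rfl
  refine ⟨{ degFr := 1, base := 𝟙 _, div := z, unit := ⟨_, hmem⟩, rel := ?_ }, rfl, rfl⟩
  rw [PNat.one_coe, pow_one, pullGp_id]
  rfl

/-! ### §3  Intrinsic characterisations of linearity in the toy category -/

/-- The vocabulary predicate `IsLinear` of the [FrdI] operations of the toy IS `deg_Fr = 1` on the model
category. [cite: MochizukiFrdI2008, Def. 1.2 (i) p.21] -/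
theorem opsData_isLinear_iff {X Y : temperedFrobenioid.category} (φ : X ⟶ Y) :
    temperedFrobenioid.opsData.IsLinear φ ↔ ModelFrobenioid.degFr φ = 1 := Iff.rfl

/-- **An endomorphism of the toy category is linear iff it is left-normal** (`∀ x ∃ t', t ≫ x = x ≫ t'`).
[cite: MochizukiFrdI2008, Thm. 3.4 (iii) p.62] -/
theorem degFr_eq_one_iff_leftNormal {X : temperedFrobenioid.category} (t : X ⟶ X) :
    ModelFrobenioid.degFr t = 1 ↔ ∀ x : X ⟶ X, ∃ t' : X ⟶ X, t ≫ x = x ≫ t' := by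
  constructor
  · intro ht x
    obtain ⟨t', ht'd, ht'z⟩ :=
      exists_translation X (ModelFrobenioid.div t ^ (ModelFrobenioid.degFr x : ℕ))
    refine ⟨t', hom_eq_of_degFr_eq_of_div_eq ?_ ?_⟩
    · rw [ModelFrobenioid.degFr_comp, ModelFrobenioid.degFr_comp, ht, ht'd, mul_one, one_mul]
    · rw [ModelFrobenioid.div_comp, ModelFrobenioid.div_comp, divisorMonoid_map_baseMap_apply,
        divisorMonoid_map_baseMap_apply, ht'z, ht'd, PNat.one_coe, pow_one, mul_comm]
  · intro h
    by_contra ht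
    -- push `t` past the translation by `Div(t) + 1`
    obtain ⟨x, hxd, hxz⟩ := exists_translation X
      ⟨Multiplicative.ofAdd (α := ℕ) (Multiplicative.toAdd (α := ℕ) (ModelFrobenioid.div t).1 + 1), trivial⟩
    obtain ⟨t', ht'⟩ := h x
    have hdeg : ModelFrobenioid.degFr t' = ModelFrobenioid.degFr t := by
      have e := congrArg ModelFrobenioid.degFr ht'
      rw [ModelFrobenioid.degFr_comp, ModelFrobenioid.degFr_comp, hxd, one_mul, mul_one] at e
      exact e.symm
    have hdiv := congrArg (fun χ : X ⟶ X => Multiplicative.toAdd (α := ℕ) (ModelFrobenioid.div χ).1) ht'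
    rw [ModelFrobenioid.div_comp, ModelFrobenioid.div_comp, divisorMonoid_map_baseMap_apply,
      divisorMonoid_map_baseMap_apply, toAdd_val_mul, toAdd_val_mul, toAdd_val_pow, toAdd_val_pow, hdeg, hxd,
      PNat.one_coe, hxz] at hdiv
    simp only [toAdd_ofAdd, one_mul] at hdiv
    -- hdiv : (a + 1) + a = toAdd (Div t') + deg t * (a + 1)
    have he : 2 ≤ (ModelFrobenioid.degFr t : ℕ) := by
      have h1 : (ModelFrobenioid.degFr t : ℕ) ≠ 1 := fun h' => ht (PNat.coe_inj.mp h')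
      have h0 := (ModelFrobenioid.degFr t).pos
      omega
    have hle : 2 * (Multiplicative.toAdd (α := ℕ) (ModelFrobenioid.div t).1 + 1) ≤
        (ModelFrobenioid.degFr t : ℕ) * (Multiplicative.toAdd (α := ℕ) (ModelFrobenioid.div t).1 + 1) :=
      Nat.mul_le_mul_right _ he
    generalize (ModelFrobenioid.degFr t : ℕ) * (Multiplicative.toAdd (α := ℕ) (ModelFrobenioid.div t).1 + 1) = P
      at hdiv hle
    omega

/-- **A morphism `φ : X → Y` of the toy category is linear iff every left-normal endomorphism of `Y` pulls back
through `φ`** (`∀ ℓ' left-normal ∃ ℓ, φ ≫ ℓ' = ℓ ≫ φ`). [cite: MochizukiFrdI2008, Thm. 3.4 (iii) p.62] -/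
theorem degFr_eq_one_iff_pullsLeftNormal {X Y : temperedFrobenioid.category} (φ : X ⟶ Y) :
    ModelFrobenioid.degFr φ = 1 ↔
      ∀ ℓ' : Y ⟶ Y, (∀ y : Y ⟶ Y, ∃ ℓ'' : Y ⟶ Y, ℓ' ≫ y = y ≫ ℓ'') →
        ∃ ℓ : X ⟶ X, φ ≫ ℓ' = ℓ ≫ φ := by
  constructor
  · intro hφ ℓ' hℓ'
    have hℓ'd : ModelFrobenioid.degFr ℓ' = 1 := (degFr_eq_one_iff_leftNormal ℓ').2 hℓ'
    obtain ⟨ℓ, hℓd, hℓz⟩ := exists_translation X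
      ((temperedFrobenioid.divisorMonoid.map (ModelFrobenioid.baseMap φ).op).hom (ModelFrobenioid.div ℓ'))
    refine ⟨ℓ, hom_eq_of_degFr_eq_of_div_eq ?_ ?_⟩
    · rw [ModelFrobenioid.degFr_comp, ModelFrobenioid.degFr_comp, hφ, hℓ'd, hℓd]
    · rw [ModelFrobenioid.div_comp, ModelFrobenioid.div_comp, divisorMonoid_map_baseMap_apply, hℓz, hℓ'd, hφ,
        PNat.one_coe, pow_one, pow_one, mul_comm]
  · intro h
    by_contra hφ
    obtain ⟨ℓ', hℓ'd, hℓ'z⟩ := exists_translation Y ⟨Multiplicative.ofAdd (α := ℕ) 1, trivial⟩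
    obtain ⟨ℓ, hℓ⟩ := h ℓ' ((degFr_eq_one_iff_leftNormal ℓ').1 hℓ'd)
    have hdiv := congrArg (fun χ : X ⟶ Y => Multiplicative.toAdd (α := ℕ) (ModelFrobenioid.div χ).1) hℓ
    rw [ModelFrobenioid.div_comp, ModelFrobenioid.div_comp, divisorMonoid_map_baseMap_apply, toAdd_val_mul,
      toAdd_val_mul, toAdd_val_pow, toAdd_val_pow, coe_divisorMonoid_map, hℓ'z, hℓ'd, PNat.one_coe] at hdiv
    simp only [toAdd_ofAdd, one_mul] at hdiv
    -- hdiv : 1 + toAdd (Div φ) = toAdd (Div φ) + deg φ * toAdd (Div ℓ)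
    have h1 : (ModelFrobenioid.degFr φ : ℕ) ≠ 1 := fun h' => hφ (PNat.coe_inj.mp h')
    have hP : (ModelFrobenioid.degFr φ : ℕ) * Multiplicative.toAdd (α := ℕ) (ModelFrobenioid.div ℓ).1 = 1 := by
      generalize (ModelFrobenioid.degFr φ : ℕ) * Multiplicative.toAdd (α := ℕ) (ModelFrobenioid.div ℓ).1 = P
        at hdiv ⊢
      omega
    exact h1 (Nat.eq_one_of_mul_eq_one_right hP)

/-! ### §4  F-2815 at the toy: EVERY record `h : Cor38Hyp Toy.temperedFrobenioid Toy.temperedFrobenioid` -/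

/-- Any fully faithful endofunctor of the toy category preserves linear morphisms.
[cite: MochizukiEtTh2009, Cor 3.8 p.81] -/
theorem degFr_map_eq_one_of_full_faithful (F : temperedFrobenioid.category ⥤ temperedFrobenioid.category)
    [F.Full] [F.Faithful] {X Y : temperedFrobenioid.category} (φ : X ⟶ Y) (hφ : ModelFrobenioid.degFr φ = 1) :
    ModelFrobenioid.degFr (F.map φ) = 1 :=
  (degFr_eq_one_iff_pullsLeftNormal (F.map φ)).2
    (pullsLeftNormal_map_of_full_faithful F φ ((degFr_eq_one_iff_pullsLeftNormal φ).1 hφ))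

/-- **Row F-2815 holds at EVERY `Cor38Hyp` record on the toy tempered Frobenioid**: every self-equivalence
`Ψ` of `Toy.temperedFrobenioid.category` — not only `𝟭` — carries linear morphisms to linear morphisms, in
both directions. [cite: MochizukiEtTh2009, Cor 3.8 p.81] -/
theorem preservesLinear_of_cor38Hyp (h : Cor38Hyp temperedFrobenioid temperedFrobenioid) : h.PreservesLinear :=
  ⟨fun _ _ φ hφ => (opsData_isLinear_iff _).2
      (degFr_map_eq_one_of_full_faithful h.Ψ.functor φ ((opsData_isLinear_iff φ).1 hφ)),
    fun _ _ φ hφ => (opsData_isLinear_iff _).2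
      (degFr_map_eq_one_of_full_faithful h.Ψ.inverse φ ((opsData_isLinear_iff φ).1 hφ))⟩

/-- Non-vacuity: `Cor38Hyp` records on the toy exist (`Ψ := 𝟭`; the one-object base is of FSM-, hence
FSMFF-type; "non-dilating" reads `True` in the trivial vocabulary). [cite: MochizukiEtTh2009, Cor 3.8 p.80] -/
theorem nonempty_cor38Hyp : Nonempty (Cor38Hyp temperedFrobenioid temperedFrobenioid) :=
  ⟨{ Ψ := CategoryTheory.Equivalence.refl
     fsmff := ⟨PadicFrd.isOfFSMType_discretePUnit.isOfFSMFFType, PadicFrd.isOfFSMType_discretePUnit.isOfFSMFFType⟩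
     nonDilating := ⟨fun _ _ => trivial, fun _ _ => trivial⟩ }⟩

/-- The universally quantified form over the toy: for ALL `Cor38Hyp` records between the toy and itself.
[cite: MochizukiEtTh2009, Cor 3.8 p.81] -/
theorem forall_cor38Hyp_preservesLinear :
    ∀ h : Cor38Hyp temperedFrobenioid temperedFrobenioid, h.PreservesLinear :=
  preservesLinear_of_cor38Hyp

end Toy

end Literature.AnabelianGeometry.EtaleTheta
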